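import Literature.Probability.RandomPlanarGeometry.SLEKappaRhoLoewnerRepr
import HarnessLib

/-!
# [LSW] proof of Lemma 8.10: (8.2) and the representation (8.4) along the Loewner chain of an arc `+`-hull

G. F. Lawler, O. Schramm, W. Werner, *Conformal restriction: the chordal case*, J. Amer. Math.
Soc. **16** (2003) 917–955, arXiv:math/0209343 (**[LSW]**), proof of Lemma 8.10, after (8.3):
"Therefore, `h_t'` is decreasing on `x < β(0)`, which proves **(8.2)**
[`h_t'(W_t) ≤ (h_t(W_t) − h_t(O_t))/(W_t − O_t) ≤ h_t'(O_t) ≤ 1`]. […] Suppose that `o < w < x_0`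
and let `w_s = ĝ_s(w)`, `o_s = ĝ_s(o)`. From the expression for `∂_s ĝ_s` we have
`∂_s log(w_s − o_s) = −2/((x_s − w_s)(x_s − o_s))`. Combining this with (8.3) shows that **(8.4)**
`M_t = exp ∫₀^S (−2(5/8)/(x_s − w_s)² − 2c/((x_s − w_s)(x_s − o_s)) − 2b/(x_s − o_s)²) ds`, where
`w = W_t` and `o = O_t`. But `o_s < w_s < x_s` for all `s ≤ S`."

Continuing `SLEKappaRhoLoewnerRepr` (the chain `(V, S)` of an arc hull `B ∈ 𝒬₊` with
`K_S = B ∩ ℍ`, `V_0 > 0`, and `Φ'_{B−y}(0) = exp(∫₀^S chainRate V y)`), this file PROVES, in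
slid coordinates (`w = 0`, `o ≤ 0`; `hullDeriv`, `hullSlope` of `SLEKappaRhoMartingale`):

* every `y ≤ 0` flows beyond `S`, to the left of the driving function, in an order-preserving
  way (`lt_swallowingTime_of_le_zero`, `map_re_lt_driving`, `map_re_lt_map_re`: "`o_s < w_s < x_s`");
* `chainRate_le_chainRate`, `hullDeriv_translate_le` — **`y ↦ Φ'_{B−y}(0) = h'(y)` is
  non-increasing on `(−∞, 0]`** ("`h_t'` is decreasing"), by comparison of the rates in (8.3);
* `hasDerivAt_map_re` — `x ↦ ĝ_S(x)` has derivative `Φ'_{B−x}(0)` on `(−∞, 0]`;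
* `hullDeriv_le_hullSlope_le`, `factors_mem_Icc` — **(8.2)**: the three factors of `M_t` lie in
  `[h'(W), 1]` (the middle one, the average of `h'` over `[o, 0]`, by monotonicity);
* `crossRate`, `hullSlope_eq_exp` — **the middle factor of (8.4)**:
  `(h(W) − h(O))/(W − O) = exp(−2 ∫₀^S ds/((x_s − w_s)(x_s − o_s)))`, by the fundamental theorem
  of calculus and the linear equation for the difference of two Loewner solutions
  (`IsSolution.sub_eq_mul_exp`).

The exponent bookkeeping of Lemma 8.10 (the three ranges of `ρ`) is in the sequel.
-/

noncomputable section

open Set Filter MeasureTheory Metric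
open scoped NNReal Topology
open UpperHalfPlane (upperHalfPlaneSet isOpen_upperHalfPlaneSet)

namespace Literature.Probability.RandomPlanarGeometry

namespace SLEKappaRho

variable {B : Set ℂ}

section ArcChain

variable {V : ℝ≥0 → ℝ} (hV : Continuous V) {S : ℝ≥0} (hB : IsPlusHull B)
  (hhull : Loewner.hull V S = B ∩ upperHalfPlaneSet) (hV0 : 0 < V 0)

include hV hB hhull hV0 in
/-- **Every real `y ≤ 0` flows beyond the terminal time `S`** of a chain with `K_S = B ∩ ℍ`,
`B ∈ 𝒬₊`, `V_0 > 0`: `y ∉ B = cl(K_S)` (real points of `B` are positive), so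
`lt_swallowingTime_of_notMem_closure_hull_holds` applies ([LSW]: the points `w = W_t`, `o = O_t`
to the left of `x_0 = inf(A* ∩ ℝ)` flow for all `s ≤ S`). [folklore] -/
theorem lt_swallowingTime_of_le_zero {y : ℝ} (hy : y ≤ 0) :
    (S : WithTop ℝ≥0) < Loewner.swallowingTime V y := by
  have hne : (y : ℂ) ≠ V 0 := by
    intro h
    have : y = V 0 := by exact_mod_cast h
    linarith
  have hyB : (y : ℂ) ∉ B := fun h ↦ by linarith [hB.2 y h]
  have hcl : (y : ℂ) ∉ closure (Loewner.hull V S) := by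
    rwa [hhull, hB.1.isBoundedHull.closure_inter_eq]
  exact Loewner.lt_swallowingTime_of_notMem_closure_hull_holds hV hne hcl

include hV hB hhull hV0 in
/-- Along the flow, a point `y ≤ 0` stays to the LEFT of the driving function:
`ĝ_s(y) < V_s` for `s ≤ S` ("`o_s < w_s < x_s` for all `s ≤ S`"). [cite: LawlerSchrammWerner2003Restriction, proof of Lemma 8.10] -/
theorem map_re_lt_driving {y : ℝ} (hy : y ≤ 0) {s : ℝ≥0} (hs : s ≤ S) :
    (Loewner.map V s y).re < V s :=
  Loewner.map_ofReal_re_lt_driving hV (by linarith)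
    (lt_of_le_of_lt (by exact_mod_cast hs) (lt_swallowingTime_of_le_zero hV hB hhull hV0 hy))

include hV hB hhull hV0 in
/-- The real flow preserves the order of the points `y ≤ 0`: `y₁ < y₂ ≤ 0 ⇒ ĝ_s(y₁) < ĝ_s(y₂)`
("`o_s < w_s`"). [cite: LawlerSchrammWerner2003Restriction, proof of Lemma 8.10] -/
theorem map_re_lt_map_re {y₁ y₂ : ℝ} (h : y₁ < y₂) (hy₂ : y₂ ≤ 0) {s : ℝ≥0} (hs : s ≤ S) :
    (Loewner.map V s y₁).re < (Loewner.map V s y₂).re :=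
  Loewner.map_ofReal_re_lt_of_lt_of_neg hV (by linarith) h
    (lt_of_le_of_lt (by exact_mod_cast hs) (lt_swallowingTime_of_le_zero hV hB hhull hV0 (h.le.trans hy₂)))
    (lt_of_le_of_lt (by exact_mod_cast hs) (lt_swallowingTime_of_le_zero hV hB hhull hV0 hy₂))

include hV hB hhull hV0 in
/-- **Comparison of the rates**: for `y₁ ≤ y₂ ≤ 0` and `s ∈ [0, S]`,
`−2/(ĝ_s(y₂) − V_s)² ≤ −2/(ĝ_s(y₁) − V_s)²` (the point `y₂` is closer to the driving function:
`ĝ_s(y₁) ≤ ĝ_s(y₂) < V_s`). This is the monotonicity "`h_t'` is decreasing on `x < β(0)`" of the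
proof of (8.2), read through (8.3). [cite: LawlerSchrammWerner2003Restriction, proof of Lemma 8.10, (8.2)–(8.3)] -/
theorem chainRate_le_chainRate {y₁ y₂ : ℝ} (h : y₁ ≤ y₂) (hy₂ : y₂ ≤ 0) {s : ℝ}
    (hs : s ∈ Icc (0 : ℝ) S) : chainRate V y₂ s ≤ chainRate V y₁ s := by
  have hsS : s.toNNReal ≤ S := Real.toNNReal_le_iff_le_coe.2 hs.2
  have h₂ : (Loewner.map V s.toNNReal y₂).re < V s.toNNReal := map_re_lt_driving hV hB hhull hV0 hy₂ hsS
  have h₁₂ : (Loewner.map V s.toNNReal y₁).re ≤ (Loewner.map V s.toNNReal y₂).re := by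
    rcases h.eq_or_lt with rfl | hlt
    · exact le_rfl
    · exact (map_re_lt_map_re hV hB hhull hV0 hlt hy₂ hsS).le
  simp only [chainRate]
  rw [div_le_div_iff₀ (by nlinarith) (by nlinarith)]
  nlinarith [mul_self_nonneg ((Loewner.map V s.toNNReal y₂).re - V s.toNNReal),
    mul_self_nonneg ((Loewner.map V s.toNNReal y₁).re - V s.toNNReal)]

include hV hB hhull hV0 in
/-- **`y ↦ Φ'_{B−y}(0) = h'(y)` is non-increasing on `(−∞, 0]`** ("`h_t'` is decreasing in
`(−∞, W_t]`", the content of the proof of (8.2)): for `y₁ ≤ y₂ ≤ 0`,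
`hullDeriv (B − y₂) ≤ hullDeriv (B − y₁)`. [cite: LawlerSchrammWerner2003Restriction, proof of Lemma 8.10, (8.2)] -/
theorem hullDeriv_translate_le {y₁ y₂ : ℝ} (h : y₁ ≤ y₂) (hy₂ : y₂ ≤ 0) :
    hullDeriv (translate B y₂) ≤ hullDeriv (translate B y₁) := by
  have hy₁ : y₁ ≤ 0 := h.trans hy₂
  have hT₁ := lt_swallowingTime_of_le_zero hV hB hhull hV0 hy₁
  have hT₂ := lt_swallowingTime_of_le_zero hV hB hhull hV0 hy₂
  have hB₁ : (y₁ : ℂ) ∉ B := fun hm ↦ by linarith [hB.2 y₁ hm]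
  have hB₂ : (y₂ : ℂ) ∉ B := fun hm ↦ by linarith [hB.2 y₂ hm]
  rw [hullDeriv_translate_eq_exp hV hhull hT₁ hB.1.isBoundedHull hB₁,
    hullDeriv_translate_eq_exp hV hhull hT₂ hB.1.isBoundedHull hB₂, Real.exp_le_exp]
  exact intervalIntegral.integral_mono_on S.coe_nonneg (intervalIntegrable_chainRate hV hT₂)
    (intervalIntegrable_chainRate hV hT₁) fun s hs ↦ chainRate_le_chainRate hV hB hhull hV0 h hy₂ hs

include hV hB hhull hV0 in
/-- **`x ↦ re ĝ_S(x)` has derivative `Φ'_{B−x}(0)` at every `x ≤ 0`** (real part of (8.3);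
`h_t'(x) = ĝ_S'(x)`). [cite: LawlerSchrammWerner2003Restriction, proof of Lemma 8.10, (8.3)] -/
theorem hasDerivAt_map_re {x : ℝ} (hx : x ≤ 0) :
    HasDerivAt (fun u : ℝ ↦ (Loewner.map V S u).re) (hullDeriv (translate B x)) x := by
  have hT := lt_swallowingTime_of_le_zero hV hB hhull hV0 hx
  have hxB : (x : ℂ) ∉ B := fun hm ↦ by linarith [hB.2 x hm]
  rw [hullDeriv_translate_eq_exp hV hhull hT hB.1.isBoundedHull hxB]
  have h := (hasDerivAt_map_exp hV hT).real_of_complex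
  rwa [Complex.ofReal_re] at h

include hV hB hhull hV0 in
/-- **(8.2): `h'(W) ≤ (h(W) − h(O))/(W − O) ≤ h'(O)`**, in slid coordinates: for `o < 0`,
`Φ'_B(0) ≤ hullSlope B o ≤ Φ'_{B−o}(0)` — the average over `[o, 0]` of the non-increasing
function `x ↦ Φ'_{B−x}(0)` lies between its values at the endpoints.
[cite: LawlerSchrammWerner2003Restriction, proof of Lemma 8.10, (8.2)] -/
theorem hullDeriv_le_hullSlope_le {o : ℝ} (ho : o < 0) :
    hullDeriv B ≤ hullSlope B o ∧ hullSlope B o ≤ hullDeriv (translate B o) := by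
  set f : ℝ → ℝ := fun x ↦ hullDeriv (translate B x) with hf
  have hanti : AntitoneOn f (uIcc o 0) := by
    rw [uIcc_of_le ho.le]
    intro x₁ hx₁ x₂ hx₂ h12
    exact hullDeriv_translate_le hV hB hhull hV0 h12 hx₂.2
  have hint : IntervalIntegrable f volume o 0 := hanti.intervalIntegrable
  have hlo : ∫ x in o..0, f 0 ≤ ∫ x in o..0, f x :=
    intervalIntegral.integral_mono_on ho.le intervalIntegrable_const hint fun x hx ↦
      hullDeriv_translate_le hV hB hhull hV0 hx.2 le_rfl
  have hhi : ∫ x in o..0, f x ≤ ∫ x in o..0, f o :=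
    intervalIntegral.integral_mono_on ho.le hint intervalIntegrable_const fun x hx ↦
      hullDeriv_translate_le hV hB hhull hV0 hx.1 (hx.2.trans le_rfl)
  simp only [intervalIntegral.integral_const, smul_eq_mul, zero_sub, hf, translate_zero] at hlo hhi
  have hneg : 0 < -o := neg_pos.2 ho
  rw [hullSlope_of_neg B ho]
  constructor
  · rw [le_div_iff₀ hneg]
    linarith
  · rw [div_le_iff₀ hneg]
    linarith

include hV hB hhull hV0 in
/-- (8.2), continued: all three factors of `M_t` lie in `[h'(W), 1]`: for `o ≤ 0`,
`Φ'_B(0) ≤ Φ'_{B−o}(0) ≤ 1` and `Φ'_B(0) ≤ hullSlope B o ≤ 1`.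
[cite: LawlerSchrammWerner2003Restriction, proof of Lemma 8.10, (8.2)] -/
theorem factors_mem_Icc {o : ℝ} (ho : o ≤ 0) :
    hullDeriv (translate B o) ∈ Icc (hullDeriv B) 1 ∧ hullSlope B o ∈ Icc (hullDeriv B) 1 := by
  have h1 : hullDeriv B ≤ hullDeriv (translate B o) := by
    simpa using hullDeriv_translate_le hV hB hhull hV0 ho le_rfl
  refine ⟨⟨h1, hullDeriv_le_one _⟩, ?_⟩
  rcases ho.lt_or_eq with hlt | rfl
  · obtain ⟨h2, h3⟩ := hullDeriv_le_hullSlope_le hV hB hhull hV0 hlt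
    exact ⟨h2, h3.trans (hullDeriv_le_one _)⟩
  · simp [hullDeriv_le_one]

/-- The cross rate `−2/((ĝ_s(w) − V_s)(ĝ_s(o) − V_s))` of the difference `w_s − o_s` of the
flows of `w = 0` and `o` ("`∂_s log(w_s − o_s) = −2/((x_s − w_s)(x_s − o_s))`").
[cite: LawlerSchrammWerner2003Restriction, proof of Lemma 8.10 (∂_s log(w_s − o_s))] -/
def crossRate (V : ℝ≥0 → ℝ) (o : ℝ) (s : ℝ) : ℝ :=
  -2 / (((Loewner.map V s.toNNReal ((0 : ℝ) : ℂ)).re - V s.toNNReal) *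
    ((Loewner.map V s.toNNReal o).re - V s.toNNReal))

include hV hB hhull hV0 in
/-- The cross rate is continuous on `[0, S]` (`IsSolution.continuousOn_coeff` for the two real
solutions). [folklore] -/
theorem continuousOn_crossRate {o : ℝ} (ho : o ≤ 0) : ContinuousOn (crossRate V o) (Icc (0 : ℝ) S) := by
  have hT₀ := lt_swallowingTime_of_le_zero hV hB hhull hV0 (le_refl (0 : ℝ))
  have hT₁ := lt_swallowingTime_of_le_zero hV hB hhull hV0 ho
  obtain ⟨g₀, hg₀⟩ := Loewner.exists_isSolution_swallowingTime_holds hV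
    (Loewner.ne_driving_of_lt_swallowingTime hT₀)
  obtain ⟨g₁, hg₁⟩ := Loewner.exists_isSolution_swallowingTime_holds hV
    (Loewner.ne_driving_of_lt_swallowingTime hT₁)
  have hST₀ : (((S : ℝ).toNNReal : ℝ≥0) : WithTop ℝ≥0) < Loewner.swallowingTime V ((0 : ℝ) : ℂ) := by
    simpa using hT₀
  have hST₁ : (((S : ℝ).toNNReal : ℝ≥0) : WithTop ℝ≥0) < Loewner.swallowingTime V o := by
    simpa using hT₁
  have hc := Loewner.IsSolution.continuousOn_coeff hV hg₁ hg₀ hST₁ hST₀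
  refine (Complex.continuous_re.comp_continuousOn hc).congr fun s hs ↦ ?_
  simp only [Function.comp_apply, crossRate, solution_eq_ofReal hV hg₀ hT₀ hs,
    solution_eq_ofReal hV hg₁ hT₁ hs]
  rw [← Complex.ofReal_sub, ← Complex.ofReal_sub, ← Complex.ofReal_mul,
    show (-2 : ℂ) = ((-2 : ℝ) : ℂ) by norm_num, ← Complex.ofReal_div, Complex.ofReal_re]

include hV hB hhull hV0 in
/-- **(8.4), the middle factor: `(h(W) − h(O))/(W − O) = exp(−2 ∫₀^S ds/((x_s − w_s)(x_s − o_s)))`.**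
In slid coordinates, for `o < 0`: `hullSlope B o = exp(∫₀^S crossRate)`. Proof: by the fundamental
theorem of calculus `∫_o^0 Φ'_{B−x}(0) dx = ĝ_S(0) − ĝ_S(o)` (`hasDerivAt_map_re`), and
`ĝ_S(0) − ĝ_S(o) = (0 − o) exp(∫₀^S −2 ds/((ĝ_s(0) − V_s)(ĝ_s(o) − V_s)))` by the linear equation
for the difference of two solutions (`IsSolution.sub_eq_mul_exp`, i.e.
"`∂_s log(w_s − o_s) = −2/((x_s − w_s)(x_s − o_s))`").
[cite: LawlerSchrammWerner2003Restriction, proof of Lemma 8.10, (8.4)] -/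
theorem hullSlope_eq_exp {o : ℝ} (ho : o < 0) :
    hullSlope B o = Real.exp (∫ s in (0 : ℝ)..S, crossRate V o s) := by
  have hT₀ := lt_swallowingTime_of_le_zero hV hB hhull hV0 (le_refl (0 : ℝ))
  have hT₁ := lt_swallowingTime_of_le_zero hV hB hhull hV0 ho.le
  -- FTC
  have hftc : ∫ x in o..0, hullDeriv (translate B x) =
      (Loewner.map V S ((0 : ℝ) : ℂ)).re - (Loewner.map V S o).re := by
    refine intervalIntegral.integral_eq_sub_of_hasDerivAt (f := fun u : ℝ ↦ (Loewner.map V S u).re)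
      (fun x hx ↦ hasDerivAt_map_re hV hB hhull hV0 ?_) ?_
    · rw [uIcc_of_le ho.le] at hx; exact hx.2
    · have hanti : AntitoneOn (fun x ↦ hullDeriv (translate B x)) (uIcc o 0) := by
        rw [uIcc_of_le ho.le]
        intro x₁ hx₁ x₂ hx₂ h12
        exact hullDeriv_translate_le hV hB hhull hV0 h12 hx₂.2
      exact hanti.intervalIntegrable
  -- the difference of the two flows
  obtain ⟨g₀, hg₀⟩ := Loewner.exists_isSolution_swallowingTime_holds hV
    (Loewner.ne_driving_of_lt_swallowingTime hT₀)
  obtain ⟨g₁, hg₁⟩ := Loewner.exists_isSolution_swallowingTime_holds hV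
    (Loewner.ne_driving_of_lt_swallowingTime hT₁)
  have hST₀ : (((S : ℝ).toNNReal : ℝ≥0) : WithTop ℝ≥0) < Loewner.swallowingTime V ((0 : ℝ) : ℂ) := by
    simpa using hT₀
  have hST₁ : (((S : ℝ).toNNReal : ℝ≥0) : WithTop ℝ≥0) < Loewner.swallowingTime V o := by
    simpa using hT₁
  have hsub := Loewner.IsSolution.sub_eq_mul_exp hV hg₁ hg₀ S.coe_nonneg hST₁ hST₀
  have hint : (∫ s in (0 : ℝ)..S, -2 / ((g₀ s - V s.toNNReal) * (g₁ s - V s.toNNReal))) =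
      ((∫ s in (0 : ℝ)..S, crossRate V o s : ℝ) : ℂ) := by
    rw [← intervalIntegral.integral_ofReal]
    refine intervalIntegral.integral_congr fun s hs ↦ ?_
    rw [uIcc_of_le S.coe_nonneg] at hs
    simp only [crossRate, solution_eq_ofReal hV hg₀ hT₀ hs, solution_eq_ofReal hV hg₁ hT₁ hs]
    push_cast
    ring
  have hS₀ : g₀ S = Loewner.map V S ((0 : ℝ) : ℂ) := by
    have := solution_eq_ofReal hV hg₀ hT₀ (s := S) ⟨S.coe_nonneg, le_rfl⟩
    rw [this, Real.toNNReal_coe, ← Loewner.map_ofReal_eq hV hT₀]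
  have hS₁ : g₁ S = Loewner.map V S o := by
    have := solution_eq_ofReal hV hg₁ hT₁ (s := S) ⟨S.coe_nonneg, le_rfl⟩
    rw [this, Real.toNNReal_coe, ← Loewner.map_ofReal_eq hV hT₁]
  rw [hint, ← Complex.ofReal_exp, hS₀, hS₁] at hsub
  have hre := congrArg Complex.re hsub
  simp only [Complex.sub_re, Complex.mul_re, Complex.ofReal_re, Complex.ofReal_im, mul_zero,
    sub_zero, zero_sub] at hre
  -- conclusion
  rw [hullSlope_of_neg B ho, hftc, hre, mul_div_cancel_left₀ _ (neg_ne_zero.2 ho.ne)]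

end ArcChain

end SLEKappaRho

end Literature.Probability.RandomPlanarGeometry

end
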